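import Literature.AlgebraicGeometry.Frobenioids.UnitEquivalenceProofs
import Literature.AlgebraicGeometry.Frobenioids.IrreducibleMorphisms
import Literature.AlgebraicGeometry.Frobenioids.EquivalenceTransportAnchors
import Literature.AlgebraicGeometry.Frobenioids.EquivalenceUnitsTransport
import HarnessLib

/-!
# Frobenioids I, §3: proofs of the category-theoreticity facts — Proposition 3.11 (ii)

Mochizuki, *The geometry of Frobenioids I: the general theory*, Kyushu J. Math. **62** (2008),
Prop. 3.11 "Frobenioids of Isotropic, Unit-trivial, and Group-like Type", (ii), statement kurims
p. 73, proof pp. 73–74 [cite: MochizukiFrdI2008, Prop. 3.11 (ii) p.73]: for `i = 1, 2` let `Φ_i` be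
the zero monoid on a connected, totally epimorphic category `D_i` of FSMFF-type, `C_i → F_{Φ_i}` a
Frobenioid of isotropic, unit-trivial and group-like type, `Ψ : C₁ ⥲ C₂` an equivalence; then `Ψ`
preserves base-isomorphisms, pull-back morphisms, linear morphisms and morphisms of Frobenius type.

PROOF-ONLY (seat abc-iut-L1-t13, D-ζ-a): this file proves the (ii)-half `FrdI.prop311ii_ofFunctor` of
the named fact `FrdI.Prop311ii_iii`, along the printed proof: since `D_i` has no FSMI-endomorphisms,
an endomorphism of `C_i` is FSMI iff it is a prime-Frobenius endomorphism [Prop. 1.11 (vi), 1.14 (i)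
and — the step the text calls "the evident structure of `F_{Φ_i}`" — the faithfulness/fullness on
`(Base, deg_Fr)` of Prop. 3.11 (i), which with `Φ = 0` makes prime-Frobenius endomorphisms
fiberwise-surjective]; prime-Frobenius morphisms are isomorphic to prime-Frobenius endomorphisms;
hence `Ψ` preserves morphisms of Frobenius type [Prop. 1.10 (v)], linear morphisms [Prop. 1.7 (iii)],
and — pre-steps being isomorphisms [Prop. 1.8 (iii)] — pull-back morphisms (`=` linear) and
base-isomorphisms (`=` Frobenius type). The (iii)-half (the functor `Ψ^Base`) is in a sequel file.
No statement is restated or strengthened.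
-/

-- `u.hom` for `u : Aut A`, `Ψ.symm.functor = Ψ.inverse` and `(F ⋙ G).obj` need default transparency.
set_option backward.isDefEq.respectTransparency false

namespace Literature.AlgebraicGeometry.Frobenioids

open CategoryTheory Opposite

universe w v v' u u'

namespace FrdI

/-! ### One Frobenioid in the setting of Prop. 3.11 -/

section Setting

variable {D : Type u} [Category.{v} D] {Φ : Dᵒᵖ ⥤ CommMonCat.{w}} {C : Type u'} [Category.{v'} C]
  {F : C ⥤ ElemFrobenioid Φ}

/-- With `Φ = 0` and all objects isotropic, every arrow is LB-invertible (co-angular by Prop. 1.4 (i),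
an isometry trivially). [cite: MochizukiFrdI2008, Prop. 3.11 p.73] -/
theorem isLBInvertible_of_zero (hzero : ∀ (X : D) (x : Φ.obj (op X)), x = 1)
    (hiso : ∀ A : C, PreFrobenioid.IsIsotropic F A) {A B : C} (φ : A ⟶ B) :
    PreFrobenioid.IsLBInvertible F φ :=
  ⟨PreFrobenioid.isCoAngular_of_isIsotropic_codomains F φ fun X _ => hiso X,
    isIsometry_of_zero hzero φ⟩

/-- In the setting of Prop. 3.11, Frobenius type ⟺ base-isomorphism.
[cite: MochizukiFrdI2008, Prop. 3.11 (ii) p.74] -/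
theorem isFrobeniusType_iff_isBaseIso_of_zero (hzero : ∀ (X : D) (x : Φ.obj (op X)), x = 1)
    (hiso : ∀ A : C, PreFrobenioid.IsIsotropic F A) {A B : C} (φ : A ⟶ B) :
    PreFrobenioid.IsFrobeniusType F φ ↔ PreFrobenioid.IsBaseIso F φ :=
  ⟨fun h => h.2, fun h => ⟨isLBInvertible_of_zero hzero hiso φ, h⟩⟩

/-- In the setting of Prop. 3.11, pull-back morphism ⟺ linear (Prop. 1.4 (ii)).
[cite: MochizukiFrdI2008, Prop. 3.11 (ii) p.74] -/
theorem isPullbackMorphism_iff_isLinear_of_zero (hF : PreFrobenioid.IsFrobenioid F)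
    (hzero : ∀ (X : D) (x : Φ.obj (op X)), x = 1) (hiso : ∀ A : C, PreFrobenioid.IsIsotropic F A)
    {A B : C} (φ : A ⟶ B) : PreFrobenioid.IsPullbackMorphism F φ ↔ PreFrobenioid.IsLinear F φ := by
  rw [PreFrobenioid.isPullbackMorphism_iff_isLBInvertible_isLinear F hF]
  exact ⟨fun h => h.2, fun h => ⟨isLBInvertible_of_zero hzero hiso φ, h⟩⟩

/-- In the setting of Prop. 3.11 every pre-step is an isomorphism (an isometric pre-step out of an
isotropic object; cf. "every pre-step of `C_i` is an isomorphism", FrdI p. 73).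
[cite: MochizukiFrdI2008, Prop. 3.11 p.73] -/
theorem isIso_of_isPreStep_of_zero (hzero : ∀ (X : D) (x : Φ.obj (op X)), x = 1)
    (hiso : ∀ A : C, PreFrobenioid.IsIsotropic F A) {A B : C} {φ : A ⟶ B}
    (hφ : PreFrobenioid.IsPreStep F φ) : IsIso φ :=
  hiso A φ (isIsometry_of_zero hzero φ) hφ

/-- In the setting of Prop. 3.11, base-isomorphic objects are isomorphic (Def. 1.3 (i)(b): "the
Frobenioid `C_i` is of … base-trivial type", FrdI p. 73). [cite: MochizukiFrdI2008, Prop. 3.11 p.73] -/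
theorem nonempty_iso_of_isBaseIso_of_zero (hF : PreFrobenioid.IsFrobenioid F)
    (hzero : ∀ (X : D) (x : Φ.obj (op X)), x = 1) (hiso : ∀ A : C, PreFrobenioid.IsIsotropic F A)
    {A B : C} (φ : A ⟶ B) (hφ : PreFrobenioid.IsBaseIso F φ) : Nonempty (B ≅ A) := by
  haveI : IsIso (PreFrobenioid.Base F φ) := hφ
  obtain ⟨X, φ₁, ψ₁, hφ₁, hψ₁, -⟩ := hF.i_b B A (asIso (PreFrobenioid.Base F φ)).symm
  haveI := isIso_of_isPreStep_of_zero hzero hiso hφ₁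
  haveI := isIso_of_isPreStep_of_zero hzero hiso hψ₁
  exact ⟨(asIso φ₁).symm ≪≫ asIso ψ₁⟩

/-- **Prop. 3.11 (i), faithfulness on `(Base, deg_Fr)`** (with trivial units).
[cite: MochizukiFrdI2008, Prop. 3.11 (i) p.73] -/
theorem eq_of_base_degFr_eq (hF : PreFrobenioid.IsFrobenioid F)
    (hzero : ∀ (X : D) (x : Φ.obj (op X)), x = 1) (hiso : ∀ A : C, PreFrobenioid.IsIsotropic F A)
    (hunit : ∀ A : C, PreFrobenioid.unitsSubgroup F A = ⊥) {A B : C} (φ ψ : A ⟶ B)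
    (hb : PreFrobenioid.Base F φ = PreFrobenioid.Base F ψ)
    (hd : PreFrobenioid.degFr F φ = PreFrobenioid.degFr F ψ) : φ = ψ := by
  obtain ⟨Y, γ, δ, u, hu, h₁, h₂⟩ := exists_unit_of_invariants_eq hF (hiso A) φ ψ hd
    ((hzero _ _).trans (hzero _ _).symm) hb
  have hu1 : u = 1 := by
    rw [hunit Y] at hu
    exact hu
  rw [h₁, h₂, hu1]
  change γ ≫ δ = γ ≫ 𝟙 Y ≫ δ
  rw [Category.id_comp]

/-- **Prime-Frobenius endomorphisms are FSMI** in the setting of Prop. 3.11 ("the evident structure of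
`F_{Φ_i}`", FrdI p. 73): irreducible by Prop. 1.10 (iv); a monomorphism and fiberwise-surjective by
the faithfulness/fullness of `C → F_Φ` on `(Base, deg_Fr)` — with `Φ = 0` there is no divisor
obstruction. [cite: MochizukiFrdI2008, Prop. 3.11 (ii) p.73] -/
theorem isFSMI_of_isPrimeFrobenius_endo (hF : PreFrobenioid.IsFrobenioid F)
    (hzero : ∀ (X : D) (x : Φ.obj (op X)), x = 1) (hiso : ∀ A : C, PreFrobenioid.IsIsotropic F A)
    (hunit : ∀ A : C, PreFrobenioid.unitsSubgroup F A = ⊥) {A : C} {φ : A ⟶ A}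
    (hφ : PreFrobenioid.IsPrimeFrobenius F φ) : IsFSMI φ := by
  haveI : IsIso (PreFrobenioid.Base F φ) := hφ.1.2
  refine ⟨⟨fun X γ => ?_, ⟨fun g g' h => ?_⟩⟩, hφ.isIrreducibleHom hF (hiso A)⟩
  · -- fiberwise surjectivity: `δ_X` of base `id` and degree `deg φ`, `δ_B` of base
    -- `Base γ ≫ Base φ⁻¹` and degree `deg γ`
    obtain ⟨δX, hδXb, hδXd⟩ :=
      exists_hom_of_base_degFr hF hzero hiso X X (𝟙 _) (PreFrobenioid.degFr F φ)
    obtain ⟨δB, hδBb, hδBd⟩ := exists_hom_of_base_degFr hF hzero hiso X A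
      (PreFrobenioid.Base F γ ≫ inv (PreFrobenioid.Base F φ)) (PreFrobenioid.degFr F γ)
    refine ⟨X, δB, δX, eq_of_base_degFr_eq hF hzero hiso hunit _ _ ?_ ?_⟩
    · rw [PreFrobenioid.base_comp, PreFrobenioid.base_comp, hδBb, hδXb, Category.assoc,
        IsIso.inv_hom_id, Category.comp_id, Category.id_comp]
    · rw [PreFrobenioid.degFr_comp, PreFrobenioid.degFr_comp, hδBd, hδXd, mul_comm]
  · apply eq_of_base_degFr_eq hF hzero hiso hunit
    · rw [← cancel_mono (PreFrobenioid.Base F φ), ← PreFrobenioid.base_comp,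
        ← PreFrobenioid.base_comp, h]
    · have := congrArg (PreFrobenioid.degFr F) h
      rw [PreFrobenioid.degFr_comp, PreFrobenioid.degFr_comp] at this
      exact mul_right_cancel this

/-- **FSMI endomorphisms are prime-Frobenius** in the setting of Prop. 3.11 ("since `D_i` is of
FSMFF-type, `D_i` has no FSMI-endomorphisms, hence …" [Prop. 1.11 (vi); 1.14 (i)], FrdI p. 73).
[cite: MochizukiFrdI2008, Prop. 3.11 (ii) p.73] -/
theorem isPrimeFrobenius_of_isFSMI_endo (hF : PreFrobenioid.IsFrobenioid F)
    (hzero : ∀ (X : D) (x : Φ.obj (op X)), x = 1) (hiso : ∀ A : C, PreFrobenioid.IsIsotropic F A)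
    (hD : IsOfFSMFFType D) {A : C} {φ : A ⟶ A} (hφ : IsFSMI φ) :
    PreFrobenioid.IsPrimeFrobenius F φ := by
  rcases PreFrobenioid.trichotomy_of_isIrreducibleHom F hF hiso hφ.2 with h | ⟨hstep, -⟩ | ⟨hpb, hirr⟩
  · exact h
  · exact (hstep.2 (isIso_of_isPreStep_of_zero hzero hiso hstep.1)).elim
  · exact (hD.not_isFSMI_of_endomorphism (PreFrobenioid.Base F φ)
      ⟨(PreFrobenioid.isFSM_iff_of_isPullbackMorphism hF hpb).1 hφ.1, hirr⟩).elim

end Setting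

/-! ### Two Frobenioids in the setting of Prop. 3.11 and an equivalence -/

section Two

variable {D₁ : Type u} [Category.{v} D₁] {Φ₁ : D₁ᵒᵖ ⥤ CommMonCat.{w}} {C₁ : Type u'}
  [Category.{v'} C₁] {D₂ : Type u} [Category.{v} D₂] {Φ₂ : D₂ᵒᵖ ⥤ CommMonCat.{w}} {C₂ : Type u'}
  [Category.{v'} C₂] {F₁ : C₁ ⥤ ElemFrobenioid Φ₁} {F₂ : C₂ ⥤ ElemFrobenioid Φ₂}

/-- `Ψ` preserves prime-Frobenius morphisms ("every prime-Frobenius morphism is abstractly equivalent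
to a prime-Frobenius endomorphism", FrdI p. 73). [cite: MochizukiFrdI2008, Prop. 3.11 (ii) p.73] -/
theorem isPrimeFrobenius_map_of_zero (hF₁ : PreFrobenioid.IsFrobenioid F₁)
    (hF₂ : PreFrobenioid.IsFrobenioid F₂) (hz₁ : ∀ (X : D₁) (x : Φ₁.obj (op X)), x = 1)
    (hz₂ : ∀ (X : D₂) (x : Φ₂.obj (op X)), x = 1) (hi₁ : ∀ A : C₁, PreFrobenioid.IsIsotropic F₁ A)
    (hi₂ : ∀ A : C₂, PreFrobenioid.IsIsotropic F₂ A)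
    (hu₁ : ∀ A : C₁, PreFrobenioid.unitsSubgroup F₁ A = ⊥) (hD₂ : IsOfFSMFFType D₂) (Ψ : C₁ ≌ C₂)
    {A B : C₁} {φ : A ⟶ B} (hφ : PreFrobenioid.IsPrimeFrobenius F₁ φ) :
    PreFrobenioid.IsPrimeFrobenius F₂ (Ψ.functor.map φ) := by
  obtain ⟨j⟩ := nonempty_iso_of_isBaseIso_of_zero hF₁ hz₁ hi₁ φ hφ.1.2
  -- the prime-Frobenius endomorphism `φ ≫ j`
  have hψ : PreFrobenioid.IsPrimeFrobenius F₁ (φ ≫ j.hom) := by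
    refine ⟨PreFrobenioid.IsFrobeniusType.comp F₁ hF₁ hφ.1
      (PreFrobenioid.isFrobeniusType_of_isIso F₁ hF₁.isPreFrobenioid j.hom), ?_⟩
    rw [PreFrobenioid.degFr_comp,
      show PreFrobenioid.degFr F₁ j.hom = 1 from PreFrobenioid.isLinear_of_isIso F₁ j.hom, mul_one]
    exact hφ.2
  have h2 : PreFrobenioid.IsPrimeFrobenius F₂ (Ψ.functor.map (φ ≫ j.hom)) :=
    isPrimeFrobenius_of_isFSMI_endo hF₂ hz₂ hi₂ hD₂
      ((isFSMI_of_isPrimeFrobenius_endo hF₁ hz₁ hi₁ hu₁ hψ).map_equivalence Ψ)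
  have e : Ψ.functor.map φ = Ψ.functor.map (φ ≫ j.hom) ≫ Ψ.functor.map j.inv := by
    rw [← Functor.map_comp, Category.assoc, j.hom_inv_id, Category.comp_id]
  rw [e]
  refine ⟨PreFrobenioid.IsFrobeniusType.comp F₂ hF₂ h2.1
    (PreFrobenioid.isFrobeniusType_of_isIso F₂ hF₂.isPreFrobenioid _), ?_⟩
  rw [PreFrobenioid.degFr_comp,
    show PreFrobenioid.degFr F₂ (Ψ.functor.map j.inv) = 1 from PreFrobenioid.isLinear_of_isIso F₂ _,
    mul_one]
  exact h2.2

/-- `Ψ` preserves morphisms of Frobenius type [composites of prime-Frobenius morphisms, Prop. 1.10 (v)].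
[cite: MochizukiFrdI2008, Prop. 3.11 (ii) p.73] -/
theorem isFrobeniusType_map_of_zero (hF₁ : PreFrobenioid.IsFrobenioid F₁)
    (hF₂ : PreFrobenioid.IsFrobenioid F₂) (hz₁ : ∀ (X : D₁) (x : Φ₁.obj (op X)), x = 1)
    (hz₂ : ∀ (X : D₂) (x : Φ₂.obj (op X)), x = 1) (hi₁ : ∀ A : C₁, PreFrobenioid.IsIsotropic F₁ A)
    (hi₂ : ∀ A : C₂, PreFrobenioid.IsIsotropic F₂ A)
    (hu₁ : ∀ A : C₁, PreFrobenioid.unitsSubgroup F₁ A = ⊥) (hD₂ : IsOfFSMFFType D₂) (Ψ : C₁ ≌ C₂)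
    {A B : C₁} {φ : A ⟶ B} (hφ : PreFrobenioid.IsFrobeniusType F₁ φ) :
    PreFrobenioid.IsFrobeniusType F₂ (Ψ.functor.map φ) := by
  have h := (PreFrobenioid.isFrobeniusType_iff_isPrimeFrobeniusComposite hF₁ φ).1 hφ
  clear hφ
  induction h with
  | of_isIso φ => exact PreFrobenioid.isFrobeniusType_of_isIso F₂ hF₂.isPreFrobenioid _
  | comp ψ χ hψ _ ih =>
    rw [Functor.map_comp]
    exact PreFrobenioid.IsFrobeniusType.comp F₂ hF₂
      (isPrimeFrobenius_map_of_zero hF₁ hF₂ hz₁ hz₂ hi₁ hi₂ hu₁ hD₂ Ψ hψ).1 ih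

/-- **Prop. 3.11 (ii)** over the cell's definitions: `Ψ` preserves base-isomorphisms, pull-back
morphisms, linear morphisms and morphisms of Frobenius type. [cite: MochizukiFrdI2008, Prop. 3.11 (ii) p.73] -/
theorem prop311ii_ofFunctor (hF₁ : PreFrobenioid.IsFrobenioid F₁) (hF₂ : PreFrobenioid.IsFrobenioid F₂)
    (Ψ : C₁ ≌ C₂) :
    (PreFrobenioidData.ofFunctor Φ₁ F₁).Prop311ii (PreFrobenioidData.ofFunctor Φ₂ F₂) Ψ := by
  intro hs₁ hs₂
  have hz₁ : ∀ (X : D₁) (x : Φ₁.obj (op X)), x = 1 := hs₁.zero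
  have hz₂ : ∀ (X : D₂) (x : Φ₂.obj (op X)), x = 1 := hs₂.zero
  have hi₁ : ∀ A : C₁, PreFrobenioid.IsIsotropic F₁ A := fun A =>
    (PreFrobenioidData.ofFunctor_isIsotropic F₁ A).1 (hs₁.isotropic.obj A)
  have hi₂ : ∀ A : C₂, PreFrobenioid.IsIsotropic F₂ A := fun A =>
    (PreFrobenioidData.ofFunctor_isIsotropic F₂ A).1 (hs₂.isotropic.obj A)
  have hu₁ : ∀ A : C₁, PreFrobenioid.unitsSubgroup F₁ A = ⊥ := fun A => hs₁.unitTrivial.obj A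
  have hu₂ : ∀ A : C₂, PreFrobenioid.unitsSubgroup F₂ A = ⊥ := fun A => hs₂.unitTrivial.obj A
  have hFr : ∀ ⦃A B : C₁⦄ (φ : A ⟶ B), PreFrobenioid.IsFrobeniusType F₁ φ →
      PreFrobenioid.IsFrobeniusType F₂ (Ψ.functor.map φ) := fun A B φ hφ =>
    isFrobeniusType_map_of_zero hF₁ hF₂ hz₁ hz₂ hi₁ hi₂ hu₁ hs₂.fsmff Ψ hφ
  have hFr' : ∀ ⦃X Y : C₂⦄ (φ : X ⟶ Y), PreFrobenioid.IsFrobeniusType F₂ φ →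
      PreFrobenioid.IsFrobeniusType F₁ (Ψ.inverse.map φ) := fun X Y φ hφ =>
    isFrobeniusType_map_of_zero hF₂ hF₁ hz₂ hz₁ hi₂ hi₁ hu₂ hs₁.fsmff Ψ.symm hφ
  have hLin : ∀ ⦃A B : C₁⦄ (φ : A ⟶ B), PreFrobenioid.IsLinear F₁ φ →
      PreFrobenioid.IsLinear F₂ (Ψ.functor.map φ) := by
    intro A B φ hφ
    rw [PreFrobenioid.isLinear_iff_isMinimalAdjoint F₂ hF₂]
    rw [PreFrobenioid.isLinear_iff_isMinimalAdjoint F₁ hF₁] at hφ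
    refine hφ.map_equivalence Ψ (S₂ := fun _ _ f => PreFrobenioid.IsFrobeniusType F₂ f)
      (fun X Y β hβ => hFr' β hβ) (fun X X' Y i β hi hβ => ?_)
    haveI := hi
    exact PreFrobenioid.IsFrobeniusType.comp F₁ hF₁
      (PreFrobenioid.isFrobeniusType_of_isIso F₁ hF₁.isPreFrobenioid i) hβ
  refine ⟨fun A B φ hφ => ?_, fun A B φ hφ => ?_, fun A B φ hφ => hLin φ hφ, fun A B φ hφ => ?_⟩
  · exact (hFr φ ((isFrobeniusType_iff_isBaseIso_of_zero hz₁ hi₁ φ).2 hφ)).2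
  · rw [PreFrobenioidData.ofFunctor_isPullbackMorphism, isPullbackMorphism_iff_isLinear_of_zero hF₂ hz₂ hi₂]
    exact hLin φ ((isPullbackMorphism_iff_isLinear_of_zero hF₁ hz₁ hi₁ φ).1
      ((PreFrobenioidData.ofFunctor_isPullbackMorphism F₁ φ).1 hφ))
  · exact (PreFrobenioidData.ofFunctor_isFrobeniusType F₂ _).2
      (hFr φ ((PreFrobenioidData.ofFunctor_isFrobeniusType F₁ φ).1 hφ))

end Two

end FrdI

end Literature.AlgebraicGeometry.Frobenioids
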